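import Summits.CriticalPhenomena.PercolationContinuityZ3.Theorems.Transplant.KNParaChainSchedNP
import Summits.CriticalPhenomena.PercolationContinuityZ3.Theorems.Transplant.SkelPhiParaRunChain
import Summits.CriticalPhenomena.PercolationContinuityZ3.Theorems.Transplant.SkelPhiParaRunClear
import HarnessLib

/-!
# N2 (frames-only node `SamePDropOfSkeletonFrm₁`, OPEN), LEVEL 1, (C) column under (R-22): the x-PARKING SCHEDULE OF RECORD and its RUN-FRAME READINGS —
# `Skelφ.xParkPrmW n ℓ h R′ ρ aLo0 A Wm Wp N : ChainPara.ParkPrm` (the parking phase in the window units of the frame `runX φ c₀ n h σ`: stride exactly `n`,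
# no drift, pieces/link box of `xPrmW`, slack `R′`, zone-box radius `ρ`), `xParkSched := (xParkPrmW …).scheduleNP 0 _ 0`, and the three facts the
# parking step's kit clause reads from LEVEL 1: the LINK REGION of a seed centre in the enlarged core is read into `region k`
# (`runX_mem_parkRegion_of_link`), a NON-far centre's STEERED SIDE HALF into `core (k+1)` (`runX_mem_parkCore_succ_of_piece`), and a FAR centre's
# ZONE BOX `cylBall t kz Rk` into `core (k+1)` (`runX_mem_parkCore_succ_of_far`, `kz + 1 ≤ ρ`) — twins of `SkelPhiParaRunChain` §2 for `ParkPrm`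

builds on p205010 (kernel theorem, internal audit signed; external expert review pending) — nothing in this file uses p205010; nothing here is a
claim about the open node `SamePDropOfSkeletonFrm₁`.
Lane `prim-bschramm`, seat `prim-bschramm-p5` (gen 15; (C) lineage; (R-22): corridor = [E-run] ⧺ [v-parking] ⧺ [u-parking]); helper file
(`--supports stmt-CriticalPhenomena-4575`).
* §1 `xParkPrmW`, `xParkPrmW_ok` (`1 ≤ n`, `2R′ + ρ ≤ n`, `ρ ≤ ⌊3nℓ/U⌋ + 1`, `2(⌊nℓ/U⌋ + 1) ≤ Wm + Wp`, `aLo0 ≤ A`), `xParkSched`,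
  `mem_xParkSched_enl_iff / _region_iff / _core_iff`;
* §2 **`runX_mem_parkRegion_of_link`**, **`runX_mem_parkCore_succ_of_piece`**, **`runX_mem_parkCore_succ_of_far`**.
[cite: MartineauTassion2017, §4.3 Lemma 4.2 (piece choice by position)] [cite: KozmaNitzan2024, §4 Lemma 12 (pp. 23–25: arrival in the target box)]
-/

noncomputable section

namespace Summit.CriticalPhenomena.PercolationContinuityZ3.Theorems.Transplant

namespace Skelφ

open Literature.Probability.Percolation Literature.Probability.LatticeModels SimpleGraph
open Literature.Probability.Percolation.KozmaNitzan.Cells (oth)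
open ChainPlanar ChainPara

variable {V : Type}

/-! ## §1 The x-parking record in window units -/

/-- **x-parking parameters in window units** (frame `runX`): along-progress exactly `n`, no drift, pieces `⌊nℓ/U⌋ + 1`, slack `R′` both ways, link box
`n × (⌊3nℓ/U⌋ + 1)` (all as `xPrmW`), zone-box radius `ρ`, core `0` = `[aLo0, A] × [−Wm, Wp]`, steps `0, …, N`. [this work] -/
def xParkPrmW (n ℓ : ℕ) (h : ℤ) (R' ρ : ℕ) (aLo0 A : ℤ) (Wm Wp N : ℕ) : ChainPara.ParkPrm where
  sLo := n
  sHi := n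
  d := 0
  Pp := n * ℓ / shearUnit n h + 1
  Pm := n * ℓ / shearUnit n h + 1
  ea := R'
  eb := R'
  La := n
  Lb := 3 * (n * ℓ) / shearUnit n h + 1
  ρ := ρ
  aLo0 := aLo0
  A := A
  Wm := Wm
  Wp := Wp
  N := N

/-- Admissibility of the x-parking record. [folklore] -/
theorem xParkPrmW_ok {n ℓ : ℕ} {h : ℤ} {R' ρ : ℕ} {aLo0 A : ℤ} {Wm Wp N : ℕ} (hn : 1 ≤ n) (hR : 2 * R' + ρ ≤ n)
    (hρL : ρ ≤ 3 * (n * ℓ) / shearUnit n h + 1) (hW : 2 * (n * ℓ / shearUnit n h + 1) ≤ Wm + Wp) (h0 : aLo0 ≤ A) :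
    ParkOK (xParkPrmW n ℓ h R' ρ aLo0 A Wm Wp N) where
  hs0 := by simp [xParkPrmW]
  hs := le_rfl
  hs1 := by simp only [xParkPrmW]; exact_mod_cast hn
  hea := by simp only [xParkPrmW]; omega
  hcontr := by simp only [xParkPrmW]; omega
  hsL := by simp [xParkPrmW]
  hρa := by simp only [xParkPrmW]; omega
  hρd := by simp only [xParkPrmW, abs_zero, add_zero]; exact_mod_cast hρL
  hPm := by simp only [xParkPrmW]; omega
  hPp := by simp only [xParkPrmW]; omega
  h0 := h0

/-- `eb = ea` for the x-parking record. [folklore] -/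
theorem xParkPrmW_eb (n ℓ : ℕ) (h : ℤ) (R' ρ : ℕ) (aLo0 A : ℤ) (Wm Wp N : ℕ) :
    (xParkPrmW n ℓ h R' ρ aLo0 A Wm Wp N).eb = (xParkPrmW n ℓ h R' ρ aLo0 A Wm Wp N).ea := rfl

/-- **The x-parking schedule of record**: the record as a planar schedule with parking along axis `0`, sign `1`, origin `0` (the run direction `σ`
lives in the frame `runX φ c₀ n h σ`). [this work] -/
def xParkSched {n ℓ : ℕ} {h : ℤ} {R' ρ : ℕ} {aLo0 A : ℤ} {Wm Wp N : ℕ} (hP : ParkOK (xParkPrmW n ℓ h R' ρ aLo0 A Wm Wp N)) : ScheduleNP :=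
  (xParkPrmW n ℓ h R' ρ aLo0 A Wm Wp N).scheduleNP 0 (σ := 1) (Or.inl rfl) 0 hP (xParkPrmW_eb n ℓ h R' ρ aLo0 A Wm Wp N)

section Readings

variable {n ℓ : ℕ} {h : ℤ} {R' ρ : ℕ} {aLo0 A : ℤ} {Wm Wp N : ℕ} (hP : ParkOK (xParkPrmW n ℓ h R' ρ aLo0 A Wm Wp N))

/-- The radius and zone radius of the x-parking schedule. [folklore] -/
theorem xParkSched_R'_ρ : (xParkSched hP).R' = R' ∧ (xParkSched hP).ρ = ρ ∧ (xParkSched hP).N = N := ⟨rfl, rfl, rfl⟩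

/-- Membership in the `R′`-enlarged core `k` of the x-parking schedule, in parking coordinates. [folklore] -/
theorem mem_xParkSched_enl_iff {k : ℕ} {y : Site 2} :
    y ∈ Finset.Icc ((xParkSched hP).lo k - (((xParkSched hP).R' : ℕ) : Site 2)) ((xParkSched hP).hi k + (((xParkSched hP).R' : ℕ) : Site 2)) ↔
      (xParkPrmW n ℓ h R' ρ aLo0 A Wm Wp N).InEnl k (y 0) (y 1) := by
  show y ∈ Finset.Icc (dLo 0 1 0 _ _ _ _ - (((xParkPrmW n ℓ h R' ρ aLo0 A Wm Wp N).ea : ℕ) : Site 2))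
      (dHi 0 1 0 _ _ _ _ + (((xParkPrmW n ℓ h R' ρ aLo0 A Wm Wp N).ea : ℕ) : Site 2)) ↔ _
  rw [dBox_enlarge (Or.inl rfl), ParkPrm.mem_enlarge_iff (Or.inl rfl) (xParkPrmW_eb n ℓ h R' ρ aLo0 A Wm Wp N)]
  simp [oth_zero]

/-- Membership in region `k` of the x-parking schedule, in parking coordinates. [folklore] -/
theorem mem_xParkSched_region_iff {k : ℕ} {y : Site 2} :
    y ∈ (xParkSched hP).region k ↔ (xParkPrmW n ℓ h R' ρ aLo0 A Wm Wp N).InRegion k (y 0) (y 1) := by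
  show y ∈ (xParkPrmW n ℓ h R' ρ aLo0 A Wm Wp N).pregion 0 1 0 k ↔ _
  rw [ParkPrm.mem_pregion_iff (Or.inl rfl)]; simp [oth_zero]

/-- Membership in core `k` of the x-parking schedule, in parking coordinates. [folklore] -/
theorem mem_xParkSched_core_iff {k : ℕ} {y : Site 2} :
    y ∈ (xParkSched hP).core k ↔ (xParkPrmW n ℓ h R' ρ aLo0 A Wm Wp N).InCore k (y 0) (y 1) := by
  rw [xParkSched, ParkPrm.scheduleNP_core, ParkPrm.mem_pcore_iff (Or.inl rfl)]; simp [oth_zero]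

/-! ## §2 The run-frame readings of the parking step -/

variable {G : SimpleGraph V} {φ : V → Site 2}

/-- **The link region of a seed centre in the enlarged core is read into the region** (x-parking): `runX t ∈ Icc (lo k − R′) (hi k + R′)` and
`w ∈ pgramPrism t n h (3ℓ) R` give `runX w ∈ region k`. [cite: KozmaNitzan2024, §4 Lemma 11 (p. 22)] -/
theorem runX_mem_parkRegion_of_link (hn : 1 ≤ n) (c₀ : V) {σ : ℤ} (hσ : σ = 1 ∨ σ = -1) {k : ℕ} {t w : V} {R : ℕ}
    (ht : runX φ c₀ n h σ t ∈ Finset.Icc ((xParkSched hP).lo k - (((xParkSched hP).R' : ℕ) : Site 2))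
      ((xParkSched hP).hi k + (((xParkSched hP).R' : ℕ) : Site 2)))
    (hw : w ∈ pgramPrism G φ t n h (3 * ℓ) R) : runX φ c₀ n h σ w ∈ (xParkSched hP).region k := by
  have ht' := (mem_xParkSched_enl_iff hP).1 ht
  obtain ⟨h0, h1⟩ := link_runX hn c₀ h hσ hw R' 0 0
  exact (mem_xParkSched_region_iff hP).2 (ParkPrm.inRegion_of_link ht' (by simpa [xPrmW, xParkPrmW] using h0) (by simpa [xPrmW, xParkPrmW] using h1))

/-- **A NON-far centre's steered side half is read into the next core** (x-parking): with `τₖ := steer k (runX t 1)` (the parking schedule's steering sign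
at the seed centre) and `¬ IsFar k (runX t 0)`, every `w ∈ pgSideHalfW t n h ℓ R σ (σ·τₖ)` has `runX w ∈ core (k+1)`.
[cite: MartineauTassion2017, §4.3 Lemma 4.2] [cite: KozmaNitzan2024, §4 Lemma 12 (pp. 23–25)] -/
theorem runX_mem_parkCore_succ_of_piece [G.LocallyFinite] (hn : 1 ≤ n) (c₀ : V) {σ : ℤ} (hσ : σ = 1 ∨ σ = -1) {k : ℕ} {t w : V} {R : ℕ}
    (ht : runX φ c₀ n h σ t ∈ Finset.Icc ((xParkSched hP).lo k - (((xParkSched hP).R' : ℕ) : Site 2))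
      ((xParkSched hP).hi k + (((xParkSched hP).R' : ℕ) : Site 2)))
    (hfar : ¬ (xParkPrmW n ℓ h R' ρ aLo0 A Wm Wp N).IsFar k (runX φ c₀ n h σ t 0))
    (hw : w ∈ pgSideHalfW G φ t n h ℓ R σ (σ * (xParkPrmW n ℓ h R' ρ aLo0 A Wm Wp N).steer k (runX φ c₀ n h σ t 1))) :
    runX φ c₀ n h σ w ∈ (xParkSched hP).core (k + 1) := by
  set P := xParkPrmW n ℓ h R' ρ aLo0 A Wm Wp N with hPdef
  set τ₀ := P.steer k (runX φ c₀ n h σ t 1) with hτ₀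
  have hτ₀' : τ₀ = 1 ∨ τ₀ = -1 := P.steer_eq_or k _
  have hστ : σ * τ₀ = 1 ∨ σ * τ₀ = -1 := by
    rcases hσ with rfl | rfl <;> rcases hτ₀' with h1 | h1 <;> simp [h1]
  have hσσ : σ * σ = 1 := by rcases hσ with h1 | h1 <;> simp [h1]
  have ht' := (mem_xParkSched_enl_iff hP).1 ht
  obtain ⟨h0, hpc⟩ := landing_runX_W hn c₀ h hσ hστ hw R' 0 0
  have hpiece : P.InPiece τ₀ (runX φ c₀ n h σ w 1 - runX φ c₀ n h σ t 1 - P.d) := by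
    have e : σ * (σ * τ₀) = τ₀ := by rw [← mul_assoc, hσσ, one_mul]
    rw [e] at hpc
    simpa [RunPrm.InPiece, ParkPrm.InPiece, xPrmW, xParkPrmW, hPdef] using hpc
  refine (mem_xParkSched_core_iff hP).2 (ParkPrm.inCore_succ_of_landing hP ht' hfar ?_ ?_ hpiece)
  · rw [h0]; exact le_rfl
  · rw [h0]; exact le_rfl

/-- **A FAR centre's zone box is read into the next core** (x-parking): if `IsFar k (runX t 0)` then every vertex of the fat prism `cylBall t kz Rk`
(`kz + 1 ≤ ρ`) has `runX w ∈ core (k+1)` — the contact PARKS. [cite: KozmaNitzan2024, §4 Lemma 12 (pp. 23–25)] -/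
theorem runX_mem_parkCore_succ_of_far (hn : 1 ≤ n) (c₀ : V) {σ : ℤ} (hσ : σ = 1 ∨ σ = -1) {k : ℕ} {t w : V} {kz Rk : ℕ} (hkz : kz + 1 ≤ ρ)
    (ht : runX φ c₀ n h σ t ∈ Finset.Icc ((xParkSched hP).lo k - (((xParkSched hP).R' : ℕ) : Site 2))
      ((xParkSched hP).hi k + (((xParkSched hP).R' : ℕ) : Site 2)))
    (hfar : (xParkPrmW n ℓ h R' ρ aLo0 A Wm Wp N).IsFar k (runX φ c₀ n h σ t 0)) (hw : w ∈ cylBall G φ t kz Rk) :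
    runX φ c₀ n h σ w ∈ (xParkSched hP).core (k + 1) := by
  have ht' := (mem_xParkSched_enl_iff hP).1 ht
  have hbox : φ w - φ t ∈ box 2 kz := (mem_cyl φ t kz w).1 (cylBall_subset_cyl G φ t kz Rk hw)
  have hσ1 : |σ| = 1 := by rcases hσ with rfl | rfl <;> simp
  have h0 : |runX φ c₀ n h σ w 0 - runX φ c₀ n h σ t 0| ≤ (xParkPrmW n ℓ h R' ρ aLo0 A Wm Wp N).ρ := by
    rw [runX_sub_runX_zero, abs_mul, hσ1, one_mul]
    have := abs_relCoord_le_of_box hbox 0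
    simp only [xParkPrmW]; omega
  have h1 : |runX φ c₀ n h σ w 1 - runX φ c₀ n h σ t 1| ≤ (xParkPrmW n ℓ h R' ρ aLo0 A Wm Wp N).ρ := by
    have hβ := abs_shearCoord_le_of_box hbox n h
    have h2 := abs_runX_sub_runX_one_le hn φ c₀ h hσ t w hβ
    have hU := shearUnit_pos hn h
    have e : ((shearUnit n h : ℤ) * kz) / (shearUnit n h : ℤ) = kz := by
      rw [mul_comm]; exact Int.mul_ediv_cancel _ hU.ne'
    rw [e] at h2
    simp only [xParkPrmW]; omega
  exact (mem_xParkSched_core_iff hP).2 (ParkPrm.box_subset_of_isFar ht' hfar h0 h1)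

end Readings

/-! ## §3 The y′-parking record and its readings (v-parking over y′-hops: top pieces, drift `v`) -/

/-- **y′-parking parameters in window units** (frame `runY`): along-progress in `[⌊(nℓ − U + 1)/U⌋, ⌊nℓ/U⌋ + 1]`, drift `v`, pieces `[0, n − v]` /
`[−(n+v), 0]`, slack `R′`, link box `(⌊3nℓ/U⌋ + 1) × n` (all as `yPrmW`), zone-box radius `ρ`, core `0` = `[aLo0, A] × [−Wm, Wp]`, steps `0, …, N`.
[this work] -/
def yParkPrmW (n ℓ : ℕ) (h v : ℤ) (R' ρ : ℕ) (aLo0 A : ℤ) (Wm Wp N : ℕ) : ChainPara.ParkPrm where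
  sLo := (((n : ℤ) * ℓ - (shearUnit n h : ℕ) + 1) / (shearUnit n h : ℕ))
  sHi := (n : ℤ) * ℓ / (shearUnit n h : ℕ) + 1
  d := v
  Pp := (n - v).toNat
  Pm := (n + v).toNat
  ea := R'
  eb := R'
  La := 3 * (n * ℓ) / shearUnit n h + 1
  Lb := n
  ρ := ρ
  aLo0 := aLo0
  A := A
  Wm := Wm
  Wp := Wp
  N := N

/-- Admissibility of the y′-parking record (the stride facts are `yPrmW_ok`'s; the parking condition `2R′ + ρ ≤ sLo`, `ρ + |v| ≤ n`, window ≥ `2(n+|v|)`).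
[folklore] -/
theorem yParkPrmW_ok {n ℓ : ℕ} {h v : ℤ} {R' ρ : ℕ} {aLo0 A : ℤ} {Wm Wp N : ℕ} (hn : 1 ≤ n) (hv : |v| ≤ n)
    (hlay : (n + h.natAbs : ℕ) ≤ (n : ℤ) * ℓ + 1)
    (hR : (2 * R' + ρ : ℤ) ≤ ((n : ℤ) * ℓ - (shearUnit n h : ℕ) + 1) / (shearUnit n h : ℕ))
    (hρv : (ρ : ℤ) + |v| ≤ n) (hW : 2 * ((n : ℤ) + |v|) ≤ Wm + Wp) (h0 : aLo0 ≤ A) :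
    ParkOK (yParkPrmW n ℓ h v R' ρ aLo0 A Wm Wp N) where
  hs0 := (yPrmW_ok hn hv hlay R' 0 0).hs0
  hs := (yPrmW_ok hn hv hlay R' 0 0).hs
  hs1 := by
    show (1 : ℤ) ≤ (n : ℤ) * ℓ / (shearUnit n h : ℕ) + 1
    have : (0 : ℤ) ≤ (n : ℤ) * ℓ / (shearUnit n h : ℕ) := Int.ediv_nonneg (by positivity) (by positivity)
    linarith
  hea := by
    show (R' : ℤ) ≤ ((n : ℤ) * ℓ - (shearUnit n h : ℕ) + 1) / (shearUnit n h : ℕ)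
    have : (0 : ℤ) ≤ ρ := by positivity
    have : (0 : ℤ) ≤ R' := by positivity
    linarith
  hcontr := by
    show 2 * (R' : ℤ) + ρ ≤ ((n : ℤ) * ℓ - (shearUnit n h : ℕ) + 1) / (shearUnit n h : ℕ)
    exact hR
  hsL := (yPrmW_ok hn hv hlay R' 0 0).hsL
  hρa := by
    show ρ ≤ 3 * (n * ℓ) / shearUnit n h + 1
    have h1 := (yPrmW_ok hn hv hlay R' 0 0).hsL
    have h2 : (1 : ℤ) ≤ (n : ℤ) * ℓ / (shearUnit n h : ℕ) + 1 := by
      have : (0 : ℤ) ≤ (n : ℤ) * ℓ / (shearUnit n h : ℕ) := Int.ediv_nonneg (by positivity) (by positivity)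
      linarith
    have hρn : (ρ : ℤ) ≤ n := le_trans (by linarith [abs_nonneg v]) hρv
    -- ρ ≤ n ≤ sLo·? : use ρ ≤ sLo + … via hR and sLo ≤ sHi ≤ La
    have h3 := (yPrmW_ok hn hv hlay R' 0 0).hs
    have h4 : (ρ : ℤ) ≤ ((n : ℤ) * ℓ - (shearUnit n h : ℕ) + 1) / (shearUnit n h : ℕ) := le_trans (by
      have : (0 : ℤ) ≤ R' := by positivity
      linarith) hR
    have h5 : ((yPrmW n ℓ h v R' 0 0).sHi : ℤ) ≤ (yPrmW n ℓ h v R' 0 0).La := h1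
    have h6 : ((yPrmW n ℓ h v R' 0 0).sLo : ℤ) ≤ (yPrmW n ℓ h v R' 0 0).sHi := h3
    have e1 : (yPrmW n ℓ h v R' 0 0).sLo = ((n : ℤ) * ℓ - (shearUnit n h : ℕ) + 1) / (shearUnit n h : ℕ) := rfl
    have e2 : ((yPrmW n ℓ h v R' 0 0).La : ℤ) = ((3 * (n * ℓ) / shearUnit n h + 1 : ℕ) : ℤ) := rfl
    have : (ρ : ℤ) ≤ ((3 * (n * ℓ) / shearUnit n h + 1 : ℕ) : ℤ) := by rw [← e2]; rw [e1] at h6; linarith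
    exact_mod_cast this
  hρd := by show (ρ : ℤ) + |v| ≤ (n : ℕ); exact_mod_cast hρv
  hPm := by
    show 2 * (n + v).toNat ≤ Wm + Wp
    have hv' := abs_le.1 hv
    have : ((n + v).toNat : ℤ) = n + v := Int.toNat_of_nonneg (by linarith)
    have hle : (v : ℤ) ≤ |v| := le_abs_self v
    omega
  hPp := by
    show 2 * (n - v).toNat ≤ Wm + Wp
    have hv' := abs_le.1 hv
    have : ((n - v).toNat : ℤ) = n - v := Int.toNat_of_nonneg (by linarith)
    have hle : -(v : ℤ) ≤ |v| := neg_le_abs v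
    omega
  h0 := h0

/-- `eb = ea` for the y′-parking record. [folklore] -/
theorem yParkPrmW_eb (n ℓ : ℕ) (h v : ℤ) (R' ρ : ℕ) (aLo0 A : ℤ) (Wm Wp N : ℕ) :
    (yParkPrmW n ℓ h v R' ρ aLo0 A Wm Wp N).eb = (yParkPrmW n ℓ h v R' ρ aLo0 A Wm Wp N).ea := rfl

/-- **The y′-parking schedule of record** (axis `0`, sign `1`, origin `0` of the frame `runY φ c₀ n h σ`). [this work] -/
def yParkSched {n ℓ : ℕ} {h v : ℤ} {R' ρ : ℕ} {aLo0 A : ℤ} {Wm Wp N : ℕ} (hP : ParkOK (yParkPrmW n ℓ h v R' ρ aLo0 A Wm Wp N)) : ScheduleNP :=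
  (yParkPrmW n ℓ h v R' ρ aLo0 A Wm Wp N).scheduleNP 0 (σ := 1) (Or.inl rfl) 0 hP (yParkPrmW_eb n ℓ h v R' ρ aLo0 A Wm Wp N)

section ReadingsY

variable {n ℓ : ℕ} {h v : ℤ} {R' ρ : ℕ} {aLo0 A : ℤ} {Wm Wp N : ℕ} (hP : ParkOK (yParkPrmW n ℓ h v R' ρ aLo0 A Wm Wp N))

/-- Membership in the `R′`-enlarged core `k` of the y′-parking schedule, in parking coordinates. [folklore] -/
theorem mem_yParkSched_enl_iff {k : ℕ} {y : Site 2} :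
    y ∈ Finset.Icc ((yParkSched hP).lo k - (((yParkSched hP).R' : ℕ) : Site 2)) ((yParkSched hP).hi k + (((yParkSched hP).R' : ℕ) : Site 2)) ↔
      (yParkPrmW n ℓ h v R' ρ aLo0 A Wm Wp N).InEnl k (y 0) (y 1) := by
  show y ∈ Finset.Icc (dLo 0 1 0 _ _ _ _ - (((yParkPrmW n ℓ h v R' ρ aLo0 A Wm Wp N).ea : ℕ) : Site 2))
      (dHi 0 1 0 _ _ _ _ + (((yParkPrmW n ℓ h v R' ρ aLo0 A Wm Wp N).ea : ℕ) : Site 2)) ↔ _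
  rw [dBox_enlarge (Or.inl rfl), ParkPrm.mem_enlarge_iff (Or.inl rfl) (yParkPrmW_eb n ℓ h v R' ρ aLo0 A Wm Wp N)]
  simp [oth_zero]

/-- Membership in region `k` of the y′-parking schedule. [folklore] -/
theorem mem_yParkSched_region_iff {k : ℕ} {y : Site 2} :
    y ∈ (yParkSched hP).region k ↔ (yParkPrmW n ℓ h v R' ρ aLo0 A Wm Wp N).InRegion k (y 0) (y 1) := by
  show y ∈ (yParkPrmW n ℓ h v R' ρ aLo0 A Wm Wp N).pregion 0 1 0 k ↔ _
  rw [ParkPrm.mem_pregion_iff (Or.inl rfl)]; simp [oth_zero]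

/-- Membership in core `k` of the y′-parking schedule. [folklore] -/
theorem mem_yParkSched_core_iff {k : ℕ} {y : Site 2} :
    y ∈ (yParkSched hP).core k ↔ (yParkPrmW n ℓ h v R' ρ aLo0 A Wm Wp N).InCore k (y 0) (y 1) := by
  rw [yParkSched, ParkPrm.scheduleNP_core, ParkPrm.mem_pcore_iff (Or.inl rfl)]; simp [oth_zero]

variable {G : SimpleGraph V} {φ : V → Site 2}

/-- **Link region into the region** (y′-parking). [cite: KozmaNitzan2024, §4 Lemma 11 (p. 22)] -/
theorem runY_mem_parkRegion_of_link (hn : 1 ≤ n) (c₀ : V) {σ : ℤ} (hσ : σ = 1 ∨ σ = -1) {k : ℕ} {t w : V} {R : ℕ}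
    (ht : runY φ c₀ n h σ t ∈ Finset.Icc ((yParkSched hP).lo k - (((yParkSched hP).R' : ℕ) : Site 2))
      ((yParkSched hP).hi k + (((yParkSched hP).R' : ℕ) : Site 2)))
    (hw : w ∈ pgramPrism G φ t n h (3 * ℓ) R) : runY φ c₀ n h σ w ∈ (yParkSched hP).region k := by
  have ht' := (mem_yParkSched_enl_iff hP).1 ht
  obtain ⟨h0, h1⟩ := link_runY hn c₀ h hσ hw v R' 0 0
  exact (mem_yParkSched_region_iff hP).2 (ParkPrm.inRegion_of_link ht' (by simpa [yPrmW, yParkPrmW] using h0) (by simpa [yPrmW, yParkPrmW] using h1))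

/-- **A NON-far centre's steered top piece is read into the next core** (y′-parking): with `τₖ := steer k (runY t 1)` and `¬ IsFar k (runY t 0)`, every
`w ∈ pgTopPieceW t n h ℓ R σ τₖ v` has `runY w ∈ core (k+1)`. [cite: MartineauTassion2017, §4.3 Lemma 4.2] [cite: KozmaNitzan2024, §4 Lemma 12 (pp. 23–25)] -/
theorem runY_mem_parkCore_succ_of_piece [G.LocallyFinite] (hn : 1 ≤ n) (c₀ : V) {σ : ℤ} (hσ : σ = 1 ∨ σ = -1) {k : ℕ} {t w : V} {R : ℕ}
    (ht : runY φ c₀ n h σ t ∈ Finset.Icc ((yParkSched hP).lo k - (((yParkSched hP).R' : ℕ) : Site 2))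
      ((yParkSched hP).hi k + (((yParkSched hP).R' : ℕ) : Site 2)))
    (hfar : ¬ (yParkPrmW n ℓ h v R' ρ aLo0 A Wm Wp N).IsFar k (runY φ c₀ n h σ t 0))
    (hw : w ∈ pgTopPieceW G φ t n h ℓ R σ ((yParkPrmW n ℓ h v R' ρ aLo0 A Wm Wp N).steer k (runY φ c₀ n h σ t 1)) v) :
    runY φ c₀ n h σ w ∈ (yParkSched hP).core (k + 1) := by
  set P := yParkPrmW n ℓ h v R' ρ aLo0 A Wm Wp N with hPdef
  set τ₀ := P.steer k (runY φ c₀ n h σ t 1) with hτ₀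
  have hτ₀' : τ₀ = 1 ∨ τ₀ = -1 := P.steer_eq_or k _
  have ht' := (mem_yParkSched_enl_iff hP).1 ht
  obtain ⟨⟨h0, h1⟩, hpc⟩ := landing_runY_W hn c₀ h hσ hτ₀' hw R' 0 0
  have hpiece : P.InPiece τ₀ (runY φ c₀ n h σ w 1 - runY φ c₀ n h σ t 1 - P.d) := by
    simpa [RunPrm.InPiece, ParkPrm.InPiece, yPrmW, yParkPrmW, hPdef] using hpc
  exact (mem_yParkSched_core_iff hP).2 (ParkPrm.inCore_succ_of_landing hP ht' hfar h0 h1 hpiece)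

/-- **A FAR centre's zone box is read into the next core** (y′-parking): `IsFar k (runY t 0)` and `kz + 1 ≤ ρ` give `runY w ∈ core (k+1)` for every
`w ∈ cylBall t kz Rk`. [cite: KozmaNitzan2024, §4 Lemma 12 (pp. 23–25)] -/
theorem runY_mem_parkCore_succ_of_far (hn : 1 ≤ n) (c₀ : V) {σ : ℤ} (hσ : σ = 1 ∨ σ = -1) {k : ℕ} {t w : V} {kz Rk : ℕ} (hkz : kz + 1 ≤ ρ)
    (ht : runY φ c₀ n h σ t ∈ Finset.Icc ((yParkSched hP).lo k - (((yParkSched hP).R' : ℕ) : Site 2))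
      ((yParkSched hP).hi k + (((yParkSched hP).R' : ℕ) : Site 2)))
    (hfar : (yParkPrmW n ℓ h v R' ρ aLo0 A Wm Wp N).IsFar k (runY φ c₀ n h σ t 0)) (hw : w ∈ cylBall G φ t kz Rk) :
    runY φ c₀ n h σ w ∈ (yParkSched hP).core (k + 1) := by
  have ht' := (mem_yParkSched_enl_iff hP).1 ht
  have hbox : φ w - φ t ∈ box 2 kz := (mem_cyl φ t kz w).1 (cylBall_subset_cyl G φ t kz Rk hw)
  have hσ1 : |σ| = 1 := by rcases hσ with rfl | rfl <;> simp
  have hU := shearUnit_pos hn h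
  have h0 : |runY φ c₀ n h σ w 0 - runY φ c₀ n h σ t 0| ≤ (yParkPrmW n ℓ h v R' ρ aLo0 A Wm Wp N).ρ := by
    have hβ := abs_shearCoord_le_of_box hbox n h
    have hβ' : |σ * shearCoord φ t n h w| ≤ (shearUnit n h : ℤ) * kz := by rw [abs_mul, hσ1, one_mul]; exact hβ
    rw [abs_le] at hβ'
    obtain ⟨hl, hu⟩ := runY_sub_runY_zero_bounds hn φ c₀ h σ t w hβ'.1 hβ'.2
    have e1 : ((shearUnit n h : ℤ) * kz) / (shearUnit n h : ℤ) = kz := by rw [mul_comm]; exact Int.mul_ediv_cancel _ hU.ne'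
    have e2 : (-((shearUnit n h : ℤ) * kz)) / (shearUnit n h : ℤ) = -kz := by
      rw [show -((shearUnit n h : ℤ) * kz) = (-(kz : ℤ)) * (shearUnit n h : ℤ) by ring, Int.mul_ediv_cancel _ hU.ne']
    rw [e1] at hu; rw [e2] at hl
    rw [abs_le]; simp only [yParkPrmW]; constructor <;> omega
  have h1 : |runY φ c₀ n h σ w 1 - runY φ c₀ n h σ t 1| ≤ (yParkPrmW n ℓ h v R' ρ aLo0 A Wm Wp N).ρ := by
    rw [runY_sub_runY_one, abs_mul, hσ1, one_mul]
    have := abs_relCoord_le_of_box hbox 0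
    simp only [yParkPrmW]; omega
  exact (mem_yParkSched_core_iff hP).2 (ParkPrm.box_subset_of_isFar ht' hfar h0 h1)

end ReadingsY

end Skelφ

end Summit.CriticalPhenomena.PercolationContinuityZ3.Theorems.Transplant

end
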